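import Mathlib
import HarnessLib
import Literature.Analysis.FluidPDE.SelfSimilar
import Literature.Analysis.FluidPDE.LocalTypeI
import Literature.Analysis.FluidPDE.VectorCalculus
import Literature.Analysis.FluidPDE.AxisymmetricEuler
import Literature.Analysis.FluidPDE.AxisymmetricVorticityTransport
import Literature.Analysis.FluidPDE.CurlIsometryCovariance
import Literature.Analysis.UnboundedOperators.HeatKernel
import Summits.NavierStokesRegularity.NavierStokesRegularity.Theorems.LocalSineTubeDoorProfileAlignedWindowRigidityAncient
import Summits.NavierStokesRegularity.NavierStokesRegularity.Theorems.PoloidalWindowDoorPoloidalWindowRigidityRotate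
import Summits.NavierStokesRegularity.NavierStokesRegularity.Theorems.PoloidalWindowDoorPoloidalWindowRigidityAxisymmetric
import Summits.NavierStokesRegularity.NavierStokesRegularity.Theorems.PoloidalWindowDoorPoloidalWindowRigidityStrata
import Summits.NavierStokesRegularity.NavierStokesRegularity.Theorems.PoloidalWindowDoorPoloidalWindowRigidityOneSlice

/-!
# Route `PoloidalWindowDoor` (staged, nsreg-p1), crux `PoloidalWindowRigidity` — the axisymmetric stratum about an
# ARBITRARY axis (any direction, any centre, one slice) is settled inside the registered class

Cell ns-regularity-ideate, seat p6 (route-directed support; land `--supports <PoloidalWindowRigidity item>` once the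
route is born). The staged `…Axisymmetric` / `…OneSlice` files settle axisymmetry about a VERTICAL axis (parallel to
the poloidal direction `e₃`; then the slice is swirl-free and KNSS Thm 5.2 applies). A TILTED axis is even easier and
needs no PDE: if a slice `v(s)` is axisymmetric about an axis of direction `d ∦ e₃` while `ω₃ ≡ 0`, then its vorticity
— an axisymmetric (rotation-equivariant) field orthogonal to the fixed vector `e₃` — is orthogonal to every rotate of
`e₃` about `d`, hence parallel to `d` everywhere, i.e. UNIDIRECTIONAL, and the rank-one stratum
(`…Strata.eq_zero_of_aligned`, item 20018) kills the profile. In the frame of the axis: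

* `cross_single_two_eq_zero_iff` — `W × e₃ = 0 ↔ W₀ = W₁ = 0`;
* `cross_single_two_eq_zero_of_isAxisymmetric` — an axisymmetric (about `e₃`) vector field everywhere orthogonal
  to a fixed vector with nonzero horizontal part is everywhere vertical (three rotations: `θ = 0, π, π/2`);
* `eq_zero_of_axisymmetric_anyAxis_slice` / `nonflatLiouville_of_axisymmetric_anyAxis_slice` — a profile of the
  class, poloidal along `e₃`, ONE of whose slices is axisymmetric about SOME axis `{L y + c : y ∈ ℝe₃}` (`L` a linear
  isometry, `c ∈ ℝ³`), vanishes identically: conjugate to the frame of the axis (`…Rotate.class_conj_linearIsometryEquiv`,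
  `…Axisymmetric.class_translate`); the conjugate is poloidal along `e' = L⁻¹e₃`; if `e' ∥ e₃` use the vertical case
  (`…OneSlice.eq_zero_of_axisymmetric_slice`), otherwise the vorticity of the axisymmetric slice is vertical
  (`IsAxisymmetric.curl` + the lemma above) and `eq_zero_of_aligned` applies.

So the residue of K2 may assume that NO slice is axisymmetric about ANY axis whatsoever (cf. SS09 Thm 1.1, which
would need local `L³`/`L^{3/2}` bounds the class does not carry — not needed here because of `ω₃ ≡ 0`).

WHAT THIS IS NOT: not a claim about Navier–Stokes regularity and not the open stub — a settled stratum of it, for a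
STAGED door route (bears_on LADDER-NS N0, rung N0-LocalTubeDoorPoloidal).
-/

noncomputable section

-- the summit and its single sub-problem share the name (CONVENTIONS §1), as in every Theorems file
set_option linter.dupNamespace false

namespace Summit.NavierStokesRegularity.NavierStokesRegularity.Theorems.PoloidalWindowDoorPoloidalWindowRigidityAnyAxis

open MeasureTheory Set Function Filter Topology TopologicalSpace Metric
open scoped RealInnerProductSpace InnerProductSpace
open Literature.Analysis Literature.Analysis.FluidPDE
open Summit.NavierStokesRegularity.NavierStokesRegularity.Theorems.LocalSineTubeDoorProfileAlignedWindowRigidityAncient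
open Summit.NavierStokesRegularity.NavierStokesRegularity.Theorems.PoloidalWindowDoorPoloidalWindowRigidityRotate
open Summit.NavierStokesRegularity.NavierStokesRegularity.Theorems.PoloidalWindowDoorPoloidalWindowRigidityAxisymmetric
open Summit.NavierStokesRegularity.NavierStokesRegularity.Theorems.PoloidalWindowDoorPoloidalWindowRigidityStrata
open Summit.NavierStokesRegularity.NavierStokesRegularity.Theorems.PoloidalWindowDoorPoloidalWindowRigidityOneSlice

variable {C : ℝ} {v : ℝ → EuclideanSpace ℝ (Fin 3) → EuclideanSpace ℝ (Fin 3)}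

/-! ### vector algebra in the frame of the axis -/

/-- `W × e₃ = (W₁, −W₀, 0)`, so `W × e₃ = 0 ↔ W₀ = 0 ∧ W₁ = 0`. -/
theorem cross_single_two_eq_zero_iff (W : EuclideanSpace ℝ (Fin 3)) :
    cross W (EuclideanSpace.single 2 1) = 0 ↔ W 0 = 0 ∧ W 1 = 0 := by
  constructor
  · intro h
    have h0 := congrArg (fun z : EuclideanSpace ℝ (Fin 3) => z 0) h
    have h1 := congrArg (fun z : EuclideanSpace ℝ (Fin 3) => z 1) h
    simp [cross, cross_apply] at h0 h1
    exact ⟨h1, h0⟩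
  · rintro ⟨h0, h1⟩
    ext i
    fin_cases i <;> simp [cross, cross_apply, h0, h1]

/-- **An axisymmetric vector field orthogonal to a fixed non-vertical vector is vertical.** If `w : ℝ³ → ℝ³` is
axisymmetric about the `x₃`-axis (`w (R_θ x) = R_θ (w x)`) and `⟪w(x), e'⟫ = 0` for all `x`, where `e'` has a nonzero
horizontal component, then `w(x) × e₃ = 0` for all `x`: indeed `⟪R_θ w(x), e'⟫ = ⟪w(R_θ x), e'⟫ = 0` for every `θ`, and
the three angles `θ = 0, π, π/2` give `e'₀ w₀ + e'₁ w₁ = 0 = e'₁ w₀ − e'₀ w₁`, whence `w₀ = w₁ = 0`. -/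
theorem cross_single_two_eq_zero_of_isAxisymmetric {w : EuclideanSpace ℝ (Fin 3) → EuclideanSpace ℝ (Fin 3)}
    (hw : IsAxisymmetric w) {e' : EuclideanSpace ℝ (Fin 3)} (he : e' 0 ≠ 0 ∨ e' 1 ≠ 0)
    (h : ∀ x, ⟪w x, e'⟫_ℝ = 0) (x : EuclideanSpace ℝ (Fin 3)) :
    cross (w x) (EuclideanSpace.single 2 1) = 0 := by
  have hθ : ∀ θ : ℝ, ⟪rotZ θ (w x), e'⟫_ℝ = 0 := fun θ => by
    rw [← hw θ x]
    exact h (rotZ θ x)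
  have e0 := hθ 0
  have e1 := hθ Real.pi
  have e2 := hθ (Real.pi / 2)
  simp only [PiLp.inner_apply, RCLike.inner_apply, conj_trivial, Fin.sum_univ_three, rotZ_apply_zero,
    rotZ_apply_one, rotZ_apply_two, Real.cos_zero, Real.sin_zero, Real.cos_pi, Real.sin_pi,
    Real.cos_pi_div_two, Real.sin_pi_div_two] at e0 e1 e2
  -- the two linear relations
  have l1 : e' 0 * w x 0 + e' 1 * w x 1 = 0 := by linear_combination (e0 - e1) / 2
  have l2 : e' 1 * w x 0 - e' 0 * w x 1 = 0 := by linear_combination e2 - (e0 + e1) / 2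
  have hq : 0 < e' 0 ^ 2 + e' 1 ^ 2 := by
    rcases he with ha | hb
    · have : 0 < e' 0 ^ 2 := by positivity
      linarith [sq_nonneg (e' 1)]
    · have : 0 < e' 1 ^ 2 := by positivity
      linarith [sq_nonneg (e' 0)]
  have hW0 : w x 0 = 0 := by
    have h3 : (e' 0 ^ 2 + e' 1 ^ 2) * w x 0 = 0 := by linear_combination e' 0 * l1 + e' 1 * l2
    exact (mul_eq_zero.1 h3).resolve_left hq.ne'
  have hW1 : w x 1 = 0 := by
    have h3 : (e' 0 ^ 2 + e' 1 ^ 2) * w x 1 = 0 := by linear_combination e' 1 * l1 - e' 0 * l2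
    exact (mul_eq_zero.1 h3).resolve_left hq.ne'
  exact (cross_single_two_eq_zero_iff _).2 ⟨hW0, hW1⟩

/-! ### the stratum -/

/-- **Poloidal + axisymmetric about an ARBITRARY axis on ONE slice ⇒ trivial.** Let `v` be a profile of the route's
Type-I class, poloidal along `e₃` on every slice. If for some linear isometry `L` of `ℝ³`, some centre `c` and some
`s < 0` the slice in the frame of the axis, `y ↦ L⁻¹ v(s, L y + c)`, is axisymmetric about the `x₃`-axis (i.e. `v(s)`
is axisymmetric about the line `c + L(ℝe₃)`), then `v ≡ 0` on the slab. -/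
theorem eq_zero_of_axisymmetric_anyAxis_slice (hrate : HasTypeITimeDecay C v)
    (hcont : ContinuousOn (uncurry v) (Iio (0 : ℝ) ×ˢ univ))
    (hmild : ∀ s t : ℝ, s < t → t < 0 → ∀ x,
      v t x = UnboundedOperators.heatExtension (v s) (t - s) x - oseenDuhamel 1 s v v t x)
    (hdiv : ∀ t < 0, VectorCalculus.IsDivFree (v t))
    (hpol : ∀ s < 0, ∀ y, ⟪curl (v s) y, EuclideanSpace.single 2 1⟫_ℝ = 0)
    (L : EuclideanSpace ℝ (Fin 3) ≃ₗᵢ[ℝ] EuclideanSpace ℝ (Fin 3)) (c : EuclideanSpace ℝ (Fin 3))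
    {s : ℝ} (hs : s < 0) (haxi : IsAxisymmetric (fun y => L.symm (v s (L y + c)))) :
    ∀ t < 0, ∀ x, v t x = 0 := by
  -- ## the profile in the frame of the axis: `u(t, y) = L⁻¹ v(t, L y + c)`
  obtain ⟨hrate₁, hcont₁, hmild₁, hdiv₁⟩ := class_translate c hrate hcont hmild hdiv
  obtain ⟨hrate', hcont', hmild', hdiv'⟩ := class_conj_linearIsometryEquiv L.symm hrate₁ hcont₁ hmild₁ hdiv₁
  simp only [LinearIsometryEquiv.symm_symm] at hrate' hcont' hmild' hdiv'
  set u : ℝ → EuclideanSpace ℝ (Fin 3) → EuclideanSpace ℝ (Fin 3) := fun t y => L.symm (v t (L y + c)) with hu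
  -- `u` is poloidal along `e' := L⁻¹ e₃`
  set e' : EuclideanSpace ℝ (Fin 3) := L.symm (EuclideanSpace.single 2 1) with he'
  have hpolu : ∀ σ < 0, ∀ y, ⟪curl (u σ) y, e'⟫_ℝ = 0 := by
    intro σ hσ y
    have h1 := (inner_curl_conj_linearIsometryEquiv_eq_zero_iff L.symm (fun z => v σ (z + c)) y e').2
    simp only [LinearIsometryEquiv.symm_symm] at h1
    refine h1 ?_
    have hc : curl (fun z => v σ (z + c)) (L y) = curl (v σ) (L y + c) := by
      rw [curl_eq_curlCLM, curl_eq_curlCLM, fderiv_comp_add_right]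
    rw [hc, he', LinearIsometryEquiv.apply_symm_apply]
    exact hpol σ hσ (L y + c)
  -- it suffices to show `u ≡ 0`
  suffices hzero : ∀ t < 0, ∀ y, u t y = 0 by
    intro t ht x
    have h := hzero t ht (L.symm (x - c))
    simp only [hu, LinearIsometryEquiv.apply_symm_apply, sub_add_cancel,
      LinearIsometryEquiv.map_eq_zero_iff] at h
    exact h
  have hbdd' := bdd_of_hasTypeITimeDecay hrate'
  by_cases hpar : cross e' (EuclideanSpace.single 2 1) = 0
  · -- ## Case A: `e' ∥ e₃` — `u` is poloidal along `e₃`; the vertical case (KNSS Thm 5.2 via `…OneSlice`)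
    obtain ⟨he0, he1⟩ := (cross_single_two_eq_zero_iff e').1 hpar
    have he2 : e' 2 ≠ 0 := by
      intro he2
      have hz : e' = 0 := by
        ext i
        fin_cases i
        · exact he0
        · exact he1
        · exact he2
      have hne : (EuclideanSpace.single 2 1 : EuclideanSpace ℝ (Fin 3)) ≠ 0 := fun h0 => by
        simpa using congrArg (fun w : EuclideanSpace ℝ (Fin 3) => w 2) h0
      exact hne ((LinearIsometryEquiv.map_eq_zero_iff L.symm).1 (he'.symm.trans hz ▸ rfl))
    have hpolu3 : ∀ σ < 0, ∀ y, ⟪curl (u σ) y, EuclideanSpace.single 2 1⟫_ℝ = 0 := by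
      intro σ hσ y
      have h1 := hpolu σ hσ y
      have hexp : ⟪curl (u σ) y, e'⟫_ℝ = e' 2 * curl (u σ) y 2 := by
        simp only [PiLp.inner_apply, RCLike.inner_apply, conj_trivial, Fin.sum_univ_three, he0, he1]
        ring
      rw [hexp] at h1
      have h2 : curl (u σ) y 2 = 0 := (mul_eq_zero.1 h1).resolve_left he2
      simp [EuclideanSpace.inner_single_right, h2]
    have haxi0 : IsAxisymmetric (fun y => u s (y + 0)) := by
      simpa only [add_zero] using haxi
    exact eq_zero_of_axisymmetric_slice hrate' hcont' hmild' hdiv' hpolu3 0 hs haxi0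
  · -- ## Case B: `e' ∦ e₃` — the vorticity of the axisymmetric slice is vertical, hence unidirectional
    have he : e' 0 ≠ 0 ∨ e' 1 ≠ 0 := by
      by_contra hne
      push Not at hne
      exact hpar ((cross_single_two_eq_zero_iff e').2 hne)
    have hC1 : ContDiff ℝ 1 (u s) := (analyticOnNhd_slice hcont' hbdd' hmild' hs).contDiff
    have hd : Differentiable ℝ (u s) := hC1.differentiable one_ne_zero
    have hal : ∀ y, cross (curl (u s) y) (EuclideanSpace.single 2 1) = 0 :=
      cross_single_two_eq_zero_of_isAxisymmetric (haxi.curl hd) he (hpolu s hs)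
    have hne : (EuclideanSpace.single 2 1 : EuclideanSpace ℝ (Fin 3)) ≠ 0 := fun h0 => by
      simpa using congrArg (fun w : EuclideanSpace ℝ (Fin 3) => w 2) h0
    exact eq_zero_of_aligned hrate' hcont' hmild' hdiv' hne hs hal

/-- **The axisymmetric stratum about an arbitrary axis is empty**: such a profile is not backward-singular. -/
theorem nonflatLiouville_of_axisymmetric_anyAxis_slice (hrate : HasTypeITimeDecay C v)
    (hcont : ContinuousOn (uncurry v) (Iio (0 : ℝ) ×ˢ univ))
    (hmild : ∀ s t : ℝ, s < t → t < 0 → ∀ x,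
      v t x = UnboundedOperators.heatExtension (v s) (t - s) x - oseenDuhamel 1 s v v t x)
    (hdiv : ∀ t < 0, VectorCalculus.IsDivFree (v t))
    (hpol : ∀ s < 0, ∀ y, ⟪curl (v s) y, EuclideanSpace.single 2 1⟫_ℝ = 0)
    (L : EuclideanSpace ℝ (Fin 3) ≃ₗᵢ[ℝ] EuclideanSpace ℝ (Fin 3)) (c : EuclideanSpace ℝ (Fin 3))
    {s : ℝ} (hs : s < 0) (haxi : IsAxisymmetric (fun y => L.symm (v s (L y + c)))) :
    ¬ IsBackwardSingularPoint v 0 :=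
  Summit.NavierStokesRegularity.NavierStokesRegularity.Theorems.PoloidalWindowDoorPoloidalWindowRigidityFlat.not_backwardSingular_of_zero
    (eq_zero_of_axisymmetric_anyAxis_slice hrate hcont hmild hdiv hpol L c hs haxi)

end Summit.NavierStokesRegularity.NavierStokesRegularity.Theorems.PoloidalWindowDoorPoloidalWindowRigidityAnyAxis

end
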